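import Literature.NumberTheory.LFunctions.FordTypeSystems
import Literature.NumberTheory.LFunctions.FordLemma32d0
import HarnessLib

/-!
# Ford's mixed mean values `K_s(P,Q;Ψ;q)` and `L_s(P,Q;Ψ;p,q,r)`

Topic `Literature/NumberTheory/LFunctions`. Everything here is PROVED; the definitions are the
counting functions of K. Ford, Proc. LMS 85 (2002), §3, (3.1)–(3.2):

* `FordVK.Ks s P Q Ψ q` = the number of solutions of (3.1)
  `∑_{i≤k} (Ψ_j(z_i) − Ψ_j(w_i)) + q^j ∑_{i≤s} (x_i^j − y_i^j) = 0 (1 ≤ j ≤ k)`,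
  `1 ≤ z_i, w_i ≤ P`, `1 ≤ x_i, y_i ≤ Q`;
* `FordVK.Ls s P Q Ψ p q r` = the number of solutions of (3.2): the same with `pq` for `q` and
  `z_i ≡ w_i (mod p^r)`;
* the integral representation `K_s = ∫_{[0,1]^k} |F(α)|^{2k} |f(α)|^{2s} dα` (`FordVK.Ks_eq_integral`),
  the trivial bound `K_s ≤ P^{2k}Q^{2s}`, the diagonal bound `K_s ≥ P^k J_{s,k}(Q)`, monotonicity of
  `L_s` in `Q`, and `K_s(P,P;(x^j);1) = J_{s+k,k}(P)`.

## References

* K. Ford, Proc. London Math. Soc. (3) 85 (2002), 565–633, §3, (3.1), (3.2) and the displays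
  following them. [Ford2002]
-/

noncomputable section

open Finset MeasureTheory Polynomial
open scoped Real

namespace Literature.NumberTheory.LFunctions
namespace FordVK

open VMV

/-! ### Frequency vectors -/

/-- The frequency vector `(Ψ_1(z), …, Ψ_k(z))` of the sum `F(α) = ∑_z e(α_1Ψ_1(z) + ⋯ + α_kΨ_k(z))`.
[cite: Ford2002, §3 (definition of `F(α; P; Ψ)`)] -/
def sysv {k : ℕ} (Ψ : PSystem k) (z : ℤ) : Fin k → ℤ := fun j => (Ψ j).eval z

/-- The frequency vector `(q x, q² x², …, q^k x^k)` of `f(α) = ∑_x e(α_1 q x + ⋯ + α_k q^k x^k)`.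
[cite: Ford2002, §3 (definition of `f(α; Q; q)`)] -/
def powv (k : ℕ) (q : ℤ) (x : ℤ) : Fin k → ℤ := fun j => q ^ (j.val + 1) * x ^ (j.val + 1)

/-- Summed frequencies over a tuple: `∑_i v(z_i)`. [folklore] -/
def tupSum {k m : ℕ} (v : ℤ → Fin k → ℤ) (z : Fin m → ℤ) : Fin k → ℤ := ∑ i, v (z i)

/-- `∑_{Z ∈ I^m} e(α · ∑_i v(Z_i)) = (∑_{z ∈ I} e(α · v(z)))^m`. [folklore] -/
theorem tp_tuples_tupSum {k : ℕ} (m : ℕ) (I : Finset ℤ) (v : ℤ → Fin k → ℤ) (α : Fin k → ℝ) :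
    tp (tuples m I) (tupSum v) α = (tp I v α) ^ m := by
  have hh := prod_tp_eq (n := k) (m := m) (fun _ => I) (fun _ => v) α
  rw [prod_const, card_univ, Fintype.card_fin] at hh
  rw [hh]
  rfl

/-- `∑_i q^j x_i^j = q^j · s_j(x)`: summed `powv` is `q^j` times the power sum. [folklore] -/
theorem tupSum_powv {k m : ℕ} (q : ℤ) (x : Fin m → ℤ) (j : Fin k) :
    tupSum (powv k q) x j = q ^ (j.val + 1) * psv k x j := by
  simp only [tupSum, powv, psv, Finset.sum_apply, Finset.mul_sum]

/-- For `q ≠ 0`: `∑_i powv(x_i) = ∑_i powv(y_i)` iff the power sums agree. [folklore] -/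
theorem tupSum_powv_eq_iff {k m : ℕ} {q : ℤ} (hq : q ≠ 0) (x y : Fin m → ℤ) :
    tupSum (powv k q) x = tupSum (powv k q) y ↔ psv k x = psv k y := by
  constructor
  · intro h; funext j
    have := congrFun h j
    rw [tupSum_powv, tupSum_powv] at this
    exact mul_left_cancel₀ (pow_ne_zero _ hq) this
  · intro h; funext j; rw [tupSum_powv, tupSum_powv, h]

/-! ### The counts `K_s` and `L_s` -/

section Counts

variable {k : ℕ}

/-- The index set `[1,P]^k × [1,Q]^s` of one side of (3.1). [cite: Ford2002, (3.1)] -/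
def KI (k s P Q : ℕ) : Finset ((Fin k → ℤ) × (Fin s → ℤ)) :=
  tuples k (Finset.Icc 1 (P : ℤ)) ×ˢ tuples s (Finset.Icc 1 (Q : ℤ))

/-- The total frequency `∑_i Ψ(z_i) + ∑_i powv_q(x_i)` of a pair `(z, x)`. [cite: Ford2002, (3.1)] -/
def Kfreq {s : ℕ} (Ψ : PSystem k) (q : ℤ) (zx : (Fin k → ℤ) × (Fin s → ℤ)) : Fin k → ℤ :=
  tupSum (sysv Ψ) zx.1 + tupSum (powv k q) zx.2

/-- **`K_s(P,Q;Ψ;q)`**, the number of solutions of (3.1). [cite: Ford2002, (3.1)] -/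
def Ks (s P Q : ℕ) (Ψ : PSystem k) (q : ℤ) : ℕ :=
  (((KI k s P Q) ×ˢ (KI k s P Q)).filter fun p => Kfreq Ψ q p.1 = Kfreq Ψ q p.2).card

/-- **`L_s(P,Q;Ψ;p,q,r)`**, the number of solutions of (3.2) (moduli `pq`, `z_i ≡ w_i mod p^r`).
[cite: Ford2002, (3.2)] -/
def Ls (s P Q : ℕ) (Ψ : PSystem k) (p : ℕ) (q : ℤ) (r : ℕ) : ℕ :=
  (((KI k s P Q) ×ˢ (KI k s P Q)).filter fun w =>
    Kfreq Ψ ((p : ℤ) * q) w.1 = Kfreq Ψ ((p : ℤ) * q) w.2 ∧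
      ∀ i : Fin k, ((p : ℤ) ^ r) ∣ w.1.1 i - w.2.1 i).card

/-- `K_s` as the mean-square count of the product index set. [folklore] -/
theorem Ks_eq_card (s P Q : ℕ) (Ψ : PSystem k) (q : ℤ) :
    (Ks s P Q Ψ q : ℝ)
      = ((((KI k s P Q) ×ˢ (KI k s P Q)).filter fun p => Kfreq Ψ q p.1 = Kfreq Ψ q p.2).card : ℝ) := rfl

/-- **The integral representation** `K_s = ∫_{[0,1]^k} |F|^{2k} |f|^{2s}`.
[cite: Ford2002, §3 ("K_s(P,Q;Ψ;q) = ∫ |F(α)^{2k} f(α)^{2s}| dα")] -/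
theorem Ks_eq_integral (s P Q : ℕ) (Ψ : PSystem k) (q : ℤ) :
    (Ks s P Q Ψ q : ℝ) = ∫ α in box k,
      ‖tp (Finset.Icc 1 (P : ℤ)) (sysv Ψ) α‖ ^ (2 * k) * ‖tp (Finset.Icc 1 (Q : ℤ)) (powv k q) α‖ ^ (2 * s) := by
  have h := integral_norm_sq_tp (n := k) (KI k s P Q) (Kfreq Ψ q)
  rw [Ks, ← h]
  refine setIntegral_congr_fun (measurableSet_box k) fun α _ => ?_
  have e : tp (KI k s P Q) (Kfreq Ψ q) α
      = tp (tuples k (Finset.Icc 1 (P : ℤ))) (tupSum (sysv Ψ)) α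
        * tp (tuples s (Finset.Icc 1 (Q : ℤ))) (tupSum (powv k q)) α := by
    rw [tp_mul]; rfl
  rw [e, tp_tuples_tupSum, tp_tuples_tupSum, norm_mul, norm_pow, norm_pow, mul_pow, ← pow_mul, ← pow_mul,
    mul_comm k 2, mul_comm s 2]

/-- Membership in `KI`. [folklore] -/
theorem mem_KI {s P Q : ℕ} {zx : (Fin k → ℤ) × (Fin s → ℤ)} :
    zx ∈ KI k s P Q ↔ (∀ i, zx.1 i ∈ Finset.Icc 1 (P : ℤ)) ∧ ∀ i, zx.2 i ∈ Finset.Icc 1 (Q : ℤ) := by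
  rw [KI, mem_product, mem_tuples, mem_tuples]

/-- `#KI = P^k Q^s`. [folklore] -/
theorem card_KI (s P Q : ℕ) : (KI k s P Q).card = P ^ k * Q ^ s := by
  rw [KI, card_product, card_tuples, card_tuples, Int.card_Icc, Int.card_Icc]
  simp

/-- **Trivial bound** `K_s ≤ P^{2k} Q^{2s}`. [cite: Ford2002, proof of Lemma 3.2 ("Since
K_s(P,Q;Ψ;q) ≤ P^{2k}Q^{2s} trivially")] -/
theorem Ks_le (s P Q : ℕ) (Ψ : PSystem k) (q : ℤ) : Ks s P Q Ψ q ≤ P ^ (2 * k) * Q ^ (2 * s) := by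
  refine (card_filter_le _ _).trans ?_
  rw [card_product, card_KI]; ring_nf; exact le_rfl

/-- **Diagonal lower bound** `K_s ≥ P^k J_{s,k}(Q)` (`q ≠ 0`): count the solutions with `z = w`.
[cite: Ford2002, proof of Lemma 3.2 ("counting the solutions of (3.1) with z_i = w_i … K ≥ (P−1)^k J_{s,k}(Q)")] -/
theorem Ks_ge_diag (s P Q : ℕ) (Ψ : PSystem k) {q : ℤ} (hq : q ≠ 0) :
    P ^ k * J k s (Finset.Icc 1 (Q : ℤ)) ≤ Ks s P Q Ψ q := by
  classical
  unfold Ks J Jc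
  set IP := Finset.Icc 1 (P : ℤ)
  set IQ := Finset.Icc 1 (Q : ℤ)
  have hcard : P ^ k * ((tuples s IQ ×ˢ tuples s IQ).filter fun xy => psv k xy.1 = psv k xy.2 + 0).card
      = ((tuples k IP) ×ˢ ((tuples s IQ ×ˢ tuples s IQ).filter fun xy => psv k xy.1 = psv k xy.2 + 0)).card := by
    rw [card_product, card_tuples, Int.card_Icc]; simp
  rw [hcard]
  refine Finset.card_le_card_of_injOn (fun w => ((w.1, w.2.1), (w.1, w.2.2))) ?_ ?_
  · intro w hw
    rw [mem_coe, mem_product, mem_filter, mem_product] at hw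
    rw [mem_coe, mem_filter, mem_product, mem_KI, mem_KI]
    refine ⟨⟨⟨mem_tuples.1 hw.1, mem_tuples.1 hw.2.1.1⟩, mem_tuples.1 hw.1, mem_tuples.1 hw.2.1.2⟩, ?_⟩
    simp only [Kfreq]
    have := hw.2.2; rw [add_zero] at this
    rw [(tupSum_powv_eq_iff hq _ _).2 this]
  · intro w _ w' _ h
    simp only [Prod.mk.injEq] at h
    exact Prod.ext h.1.1 (Prod.ext h.1.2 h.2.2)

/-- `L_s ≤ K_s` with moduli `pq` (drop the congruences). [folklore] -/
theorem Ls_le_Ks (s P Q : ℕ) (Ψ : PSystem k) (p : ℕ) (q : ℤ) (r : ℕ) :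
    Ls s P Q Ψ p q r ≤ Ks s P Q Ψ ((p : ℤ) * q) := by
  unfold Ls Ks
  exact card_le_card (fun w hw => by rw [mem_filter] at hw ⊢; exact ⟨hw.1, hw.2.1⟩)

/-- **`L_s` is non-decreasing in `Q`.** [cite: Ford2002, proof of Lemma 3.4 ("the fact that
L_s(P,Q;Φ;p,q,r) is a non-decreasing function of Q")] -/
theorem Ls_mono {s P Q Q' : ℕ} (hQ : Q ≤ Q') (Ψ : PSystem k) (p : ℕ) (q : ℤ) (r : ℕ) :
    Ls s P Q Ψ p q r ≤ Ls s P Q' Ψ p q r := by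
  unfold Ls
  refine card_le_card fun w hw => ?_
  rw [mem_filter, mem_product, mem_KI, mem_KI] at hw ⊢
  have hsub : ∀ x : ℤ, x ∈ Finset.Icc 1 (Q : ℤ) → x ∈ Finset.Icc 1 (Q' : ℤ) := fun x hx => by
    rw [Finset.mem_Icc] at hx ⊢; exact ⟨hx.1, hx.2.trans (by exact_mod_cast hQ)⟩
  exact ⟨⟨⟨hw.1.1.1, fun i => hsub _ (hw.1.1.2 i)⟩, hw.1.2.1, fun i => hsub _ (hw.1.2.2 i)⟩, hw.2⟩

/-- **`K_s` is non-decreasing in `Q`.** [folklore] -/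
theorem Ks_mono {s P Q Q' : ℕ} (hQ : Q ≤ Q') (Ψ : PSystem k) (q : ℤ) :
    Ks s P Q Ψ q ≤ Ks s P Q' Ψ q := by
  unfold Ks
  refine card_le_card fun w hw => ?_
  rw [mem_filter, mem_product, mem_KI, mem_KI] at hw ⊢
  have hsub : ∀ x : ℤ, x ∈ Finset.Icc 1 (Q : ℤ) → x ∈ Finset.Icc 1 (Q' : ℤ) := fun x hx => by
    rw [Finset.mem_Icc] at hx ⊢; exact ⟨hx.1, hx.2.trans (by exact_mod_cast hQ)⟩
  exact ⟨⟨⟨hw.1.1.1, fun i => hsub _ (hw.1.1.2 i)⟩, hw.1.2.1, fun i => hsub _ (hw.1.2.2 i)⟩, hw.2⟩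

end Counts

/-! ### `K_s(P,P;(x^j);1) = J_{s+k,k}(P)` -/

/-- For the initial system `Ψ_j = x^j` and `q = 1`: `K_s(P,P;Ψ;1) = J_{k+s,k}([1,P])`.
[cite: Ford2002, proof of Lemma 3.4 ("J_{s+k,k}(P) = K_s(P,P;Ψ;1)")] -/
theorem Ks_powSys (k s P : ℕ) : Ks s P P (powSys k) 1 = J k (k + s) (Finset.Icc 1 (P : ℤ)) := by
  classical
  rw [J_add_eq_card, Ks]
  have hv : ∀ z : ℤ, sysv (powSys k) z = powv k 1 z := by
    intro z; funext j; simp [sysv, powSys, powv]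
  have hfreq : ∀ zx : (Fin k → ℤ) × (Fin s → ℤ), Kfreq (powSys k) 1 zx = psv k zx.1 + psv k zx.2 := by
    intro zx
    simp only [Kfreq]
    congr 1
    · funext j; simp only [tupSum, Finset.sum_apply, hv, powv, one_pow, one_mul, psv]
    · funext j; rw [tupSum_powv, one_pow, one_mul]
  unfold KI
  congr 1
  refine Finset.filter_congr fun w _ => ?_
  rw [hfreq, hfreq]

end FordVK
end Literature.NumberTheory.LFunctions
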